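import Summits.Ventures.Crystal3D.Theorems.StickyWulffConstantNoReconstructionGainAffine
import Summits.Ventures.Crystal3D.Theorems.StickyWulffConstantNoReconstructionGainAdhesionTCapDefs
import HarnessLib

/-!
# K1 ⟹ the CAPPED T-FORM adhesion law for fcc hosts (crux `NoReconstructionGain` → lane T's `stub_barlowAdhesionTCap`)

HONEST FRAMING. Part of the venture `Summits/Ventures/Crystal3D` (cell `crystal3d-full`), helper `--supports` the
crux `NoReconstructionGain` (stmt-Ventures-19144, route `route-Ventures-StickyWulffConstant`), lead wulff-p1 g19;
serves lane T's re-typed stub `stub_barlowAdhesionTCap` (crux `TextureLiminfV5`, stmt-Ventures-23912; cf-p1 DECISION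
(clx) «ADHESION RE-LINED», 2026-08-29T08:12:53Z).  CONDITIONAL ON THE CRUX: the main theorem takes
`NoReconstructionGain` as a hypothesis; nothing here proves it.

* `movedPiece_deficit_le` / `movedBody_deficit_le` — the clamped slab of a moved lattice `L Λ₀ + s` in
  `ν`-coordinates (`a ≤ ⟪z,ν⟫ ≤ b`, `‖z‖² − ⟪z,ν⟫² ≤ ρ²`): for thickness `T = b − a ≥ 1` and ANY radius `ρ ≥ 2`,
  `D ≤ 2φ(L⁻¹ν)πρ² + C·T·ρ` — thin case `T ≤ ρ` = `affineSampleDeficit_upper_unif` after a rotation `ν ↦ e₃`;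
  tall case `T > ρ`: chop into `⌈T/ρ⌉` slabs of equal thickness `∈ [1, ρ]` and use `D(A ∪ B) ≤ D(A) + D(B)`
  (every `ρ²` is then `≤ Tρ`).
* `barlowAdhesionTCapFcc_of_noReconstructionGain'` — **K1 ⟹ the capped T-form for fcc hosts** (explicit
  statement = the `Prop` `BarlowAdhesionTCapFcc` of `…NoReconstructionGainAdhesionTCapDefs`): assuming the crux,
  there are `R ≥ 1`, `C` such that for every frame `L`, origin `s`, unit `ν`, cap `h ≥ 0`, `ρ ≥ R` and every
  finite packing `X` with heights in `[−2R, h]`, radial part `≤ ρ`, and the slab `{−2R ≤ ⟪p,ν⟫ ≤ −R}` of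
  `stacking L s constHagg` complete: with `P := X ∩ stacking`, `B := X ∖ stacking` and `Q :=` the vacant sites of
  the cell's lattice body up to height `h + 1`, `#cross(P,B) ≤ D(B) + (#cross(P,Q) − D(Q)) + C(1+h)ρ`.
  Proof: `noReconstructionGain_affine` gives `D(X) ≥ 2φπρ² − Cρ`; `D(X) = D(P) + D(B) − #cross(P,B)` and
  `D(P ∪ Q) = D(P) + D(Q) − #cross(P,Q)` (`contactDeficiency_sdiff_split`); `movedBody_deficit_le` bounds
  `D(P ∪ Q)` by `2φπρ² + C(h + 1 + 2R)ρ`.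
* `barlowAdhesionTCapFcc_of_noReconstructionGain` — the same packaged as lane T's `Prop`:
  `NoReconstructionGain → BarlowAdhesionTCapFcc` (`…NoReconstructionGainAdhesionTCapDefs`).

WHAT THIS IS NOT: not the capped T-form for non-fcc Hägg words (`BarlowAdhesionTCap`, σ arbitrary — K1 gives nothing
there: line conservation is fcc-only); not the uncapped T-form (strictly stronger than the crux on tall rough lattice
parts, dropped by (clx)); not a proof of the crux.  Rung F-C1 not moved.
-/

noncomputable section

namespace Summit.Ventures.Crystal3D.Theorems

open Summit.Ventures.Crystal3D Finset
open Literature.MathematicalPhysics.StatisticalMechanics (fccStacking barlowStacking constHagg isHaggSeq_const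
  le_dist_of_mem_barlowStacking_ideal contactDeficiency)
open scoped InnerProductSpace

/-! ## Clamped slabs of a moved lattice in `ν`-coordinates: finiteness and the deficit bound for any thickness -/

/-- The deficit bound for ONE piece of thickness `τ ∈ [1, ρ]` of a moved lattice in `ν`-coordinates
(`affineSampleDeficit_upper_unif` after a rotation taking `ν` to `e₃`). -/
theorem movedPiece_deficit_le : ∃ C : ℝ, ∀ (L : EuclideanSpace ℝ (Fin 3) ≃ₗᵢ[ℝ] EuclideanSpace ℝ (Fin 3))
    (s ν : EuclideanSpace ℝ (Fin 3)), ‖ν‖ = 1 → ∀ τ : ℝ, 1 ≤ τ → ∀ a b : ℝ, b - a = τ →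
    ∀ ρ : ℝ, τ ≤ ρ → ∀ Pc : Finset (EuclideanSpace ℝ (Fin 3)),
      (∀ z, z ∈ Pc ↔ (z ∈ (fun r => L r + s) '' fccStacking 1 (Real.sqrt (2 / 3)) ∧ a ≤ ⟪z, ν⟫_ℝ ∧
        ⟪z, ν⟫_ℝ ≤ b ∧ ‖z‖ ^ 2 - ⟪z, ν⟫_ℝ ^ 2 ≤ ρ ^ 2)) →
      contactDeficiency Pc ≤
        2 * (Real.sqrt 2 / 4 * ∑ᶠ w ∈ {w ∈ fccStacking 1 (Real.sqrt (2 / 3)) | ‖w‖ = 1},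
          |⟪w, L.symm ν⟫_ℝ|) * Real.pi * ρ ^ 2 + C * (1 + τ) * ρ := by
  classical
  obtain ⟨C, hC⟩ := affineSampleDeficit_upper_unif
  refine ⟨C, fun L s ν hν τ hτ a b hab ρ hρ Pc hPc => ?_⟩
  obtain ⟨g, hg⟩ := exists_linearIsometryEquiv_apply_eq_single_two ν hν
  set e₃ : EuclideanSpace ℝ (Fin 3) := EuclideanSpace.single (2 : Fin 3) (1 : ℝ) with he₃
  have hp2 : ∀ z : EuclideanSpace ℝ (Fin 3), g z 2 = ⟪z, ν⟫_ℝ := by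
    intro z
    have : g z 2 = ⟪g z, e₃⟫_ℝ := by rw [he₃, EuclideanSpace.inner_single_right]; simp
    rw [this, ← hg, LinearIsometryEquiv.inner_map_map]
  have hp01 : ∀ z : EuclideanSpace ℝ (Fin 3), g z 0 ^ 2 + g z 1 ^ 2 = ‖z‖ ^ 2 - ⟪z, ν⟫_ℝ ^ 2 := by
    intro z
    rw [sq_add_sq_eq_norm_sq_sub, ← hp2 z, LinearIsometryEquiv.norm_map]
    congr 1
    rw [EuclideanSpace.inner_single_right]; simp
  have hsymm : (L.trans g).symm e₃ = L.symm ν := by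
    rw [LinearIsometryEquiv.symm_trans, LinearIsometryEquiv.trans_apply, ← hg,
      LinearIsometryEquiv.symm_apply_apply]
  have h := hC (L.trans g) (g s) τ hτ a b hab ρ hρ (Pc.image g) ?_
  · rw [contactDeficiency_image_of_isometry g.isometry, hsymm] at h
    exact h
  · intro p
    rw [Finset.mem_image]
    constructor
    · rintro ⟨z, hz, rfl⟩
      obtain ⟨⟨r, hrΛ, hrz⟩, h1, h2, h3⟩ := (hPc z).1 hz
      refine ⟨⟨r, hrΛ, ?_⟩, ?_, ?_, ?_⟩
      · show (L.trans g) r + g s = g z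
        rw [← hrz, LinearIsometryEquiv.trans_apply, map_add]
      · rw [hp2]; exact h1
      · rw [hp2]; exact h2
      · rw [hp01]; exact h3
    · rintro ⟨⟨r, hrΛ, hrp⟩, h1, h2, h3⟩
      have hrp' : g (L r + s) = p := by
        rw [← hrp]
        show g (L r + s) = (L.trans g) r + g s
        rw [LinearIsometryEquiv.trans_apply, map_add]
      subst hrp'
      rw [hp2] at h1 h2
      rw [hp01] at h3
      exact ⟨L r + s, (hPc _).2 ⟨⟨r, hrΛ, rfl⟩, h1, h2, h3⟩, rfl⟩

set_option maxHeartbeats 400000 in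
/-- **The clamped slab of a moved lattice in `ν`-coordinates, any thickness `T ≥ 1`, any radius `ρ ≥ 2`:**
`D ≤ 2φ(L⁻¹ν)πρ² + C·T·ρ` (thin case `T ≤ ρ` directly; tall case by chopping into `⌈T/ρ⌉` slabs of equal
thickness `∈ [1, ρ]`, where every `ρ²` is `≤ Tρ`). -/
theorem movedBody_deficit_le : ∃ C : ℝ, 0 ≤ C ∧
    ∀ (L : EuclideanSpace ℝ (Fin 3) ≃ₗᵢ[ℝ] EuclideanSpace ℝ (Fin 3)) (s ν : EuclideanSpace ℝ (Fin 3)),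
    ‖ν‖ = 1 → ∀ T : ℝ, 1 ≤ T → ∀ a b : ℝ, b - a = T → ∀ ρ : ℝ, 2 ≤ ρ →
    ∀ Bd : Finset (EuclideanSpace ℝ (Fin 3)),
      (∀ z, z ∈ Bd ↔ (z ∈ (fun r => L r + s) '' fccStacking 1 (Real.sqrt (2 / 3)) ∧ a ≤ ⟪z, ν⟫_ℝ ∧
        ⟪z, ν⟫_ℝ ≤ b ∧ ‖z‖ ^ 2 - ⟪z, ν⟫_ℝ ^ 2 ≤ ρ ^ 2)) →
      contactDeficiency Bd ≤
        2 * (Real.sqrt 2 / 4 * ∑ᶠ w ∈ {w ∈ fccStacking 1 (Real.sqrt (2 / 3)) | ‖w‖ = 1},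
          |⟪w, L.symm ν⟫_ℝ|) * Real.pi * ρ ^ 2 + C * T * ρ := by
  classical
  obtain ⟨C₂, hC₂⟩ := movedPiece_deficit_le
  -- per-piece constant `K₀ ρ²`
  set K₀ : ℝ := 6 * Real.sqrt 2 * Real.pi + 2 * |C₂| with hK₀
  have hK₀0 : 0 ≤ K₀ := by positivity
  refine ⟨2 * K₀, by positivity, fun L s ν hν T hT a b hab ρ hρ Bd hBd => ?_⟩
  have hν' : ‖L.symm ν‖ = 1 := by rw [LinearIsometryEquiv.norm_map, hν]
  obtain ⟨hφ0, hφ1⟩ := phi_finsum_bounds hν'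
  have hπ : 0 ≤ Real.pi := Real.pi_pos.le
  have hρ0 : 0 ≤ ρ := by linarith
  -- a piece of thickness `τ ∈ [1, ρ]` costs at most `K₀ ρ²`
  have hpiece : ∀ τ : ℝ, 1 ≤ τ → τ ≤ ρ → ∀ a' b' : ℝ, b' - a' = τ →
      ∀ Pc : Finset (EuclideanSpace ℝ (Fin 3)),
      (∀ z, z ∈ Pc ↔ (z ∈ (fun r => L r + s) '' fccStacking 1 (Real.sqrt (2 / 3)) ∧ a' ≤ ⟪z, ν⟫_ℝ ∧
        ⟪z, ν⟫_ℝ ≤ b' ∧ ‖z‖ ^ 2 - ⟪z, ν⟫_ℝ ^ 2 ≤ ρ ^ 2)) →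
      contactDeficiency Pc ≤ K₀ * ρ ^ 2 := by
    intro τ hτ1 hτρ a' b' hab' Pc hPc
    have h := hC₂ L s ν hν τ hτ1 a' b' hab' ρ hτρ Pc hPc
    have hτρ0 : (0:ℝ) ≤ (1 + τ) * ρ := mul_nonneg (by linarith) hρ0
    have h1 : C₂ * (1 + τ) * ρ ≤ 2 * |C₂| * ρ ^ 2 := by
      have e1 : C₂ * (1 + τ) * ρ ≤ |C₂| * ((1 + τ) * ρ) := by
        rw [mul_assoc]; exact mul_le_mul_of_nonneg_right (le_abs_self C₂) hτρ0
      have e2 : (1 + τ) * ρ ≤ 2 * ρ ^ 2 := by nlinarith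
      have e3 : |C₂| * ((1 + τ) * ρ) ≤ |C₂| * (2 * ρ ^ 2) := mul_le_mul_of_nonneg_left e2 (abs_nonneg _)
      linarith
    have h2 : 2 * (Real.sqrt 2 / 4 * ∑ᶠ w ∈ {w ∈ fccStacking 1 (Real.sqrt (2 / 3)) | ‖w‖ = 1},
        |⟪w, L.symm ν⟫_ℝ|) * Real.pi * ρ ^ 2 ≤ 6 * Real.sqrt 2 * Real.pi * ρ ^ 2 := by
      have e1 := mul_le_mul_of_nonneg_right hφ1 (by positivity : (0:ℝ) ≤ 2 * Real.pi * ρ ^ 2)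
      have e2 : 2 * (Real.sqrt 2 / 4 * ∑ᶠ w ∈ {w ∈ fccStacking 1 (Real.sqrt (2 / 3)) | ‖w‖ = 1},
          |⟪w, L.symm ν⟫_ℝ|) * Real.pi * ρ ^ 2 = (Real.sqrt 2 / 4 * ∑ᶠ w ∈ {w ∈ fccStacking 1
          (Real.sqrt (2 / 3)) | ‖w‖ = 1}, |⟪w, L.symm ν⟫_ℝ|) * (2 * Real.pi * ρ ^ 2) := by ring
      have e3 : 6 * Real.sqrt 2 * Real.pi * ρ ^ 2 = 3 * Real.sqrt 2 * (2 * Real.pi * ρ ^ 2) := by ring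
      rw [e2, e3]; exact e1
    have hK : K₀ * ρ ^ 2 = 6 * Real.sqrt 2 * Real.pi * ρ ^ 2 + 2 * |C₂| * ρ ^ 2 := by rw [hK₀]; ring
    rw [hK]; linarith [h, h1, h2]
  by_cases hTρ : T ≤ ρ
  · -- thin: one piece
    have h := hC₂ L s ν hν T hT a b hab ρ hTρ Bd hBd
    have hTρ0 : (0:ℝ) ≤ (1 + T) * ρ := mul_nonneg (by linarith) hρ0
    have h1 : C₂ * (1 + T) * ρ ≤ 2 * K₀ * T * ρ := by
      have e1 : C₂ * (1 + T) * ρ ≤ |C₂| * ((1 + T) * ρ) := by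
        rw [mul_assoc]; exact mul_le_mul_of_nonneg_right (le_abs_self C₂) hTρ0
      have e2 : (1 + T) * ρ ≤ 2 * T * ρ := mul_le_mul_of_nonneg_right (by linarith) hρ0
      have e3 : |C₂| * ((1 + T) * ρ) ≤ |C₂| * (2 * T * ρ) := mul_le_mul_of_nonneg_left e2 (abs_nonneg _)
      have e4 : |C₂| ≤ K₀ := by
        rw [hK₀]; nlinarith [abs_nonneg C₂, Real.sqrt_nonneg 2, hπ, mul_nonneg (Real.sqrt_nonneg 2) hπ]
      have e5 : |C₂| * (2 * T * ρ) ≤ K₀ * (2 * T * ρ) :=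
        mul_le_mul_of_nonneg_right e4 (by nlinarith)
      nlinarith
    linarith
  · -- tall: chop into `m = ⌈T/ρ⌉` pieces of thickness `τ = T/m ∈ [1, ρ]`
    push Not at hTρ
    have hρpos : 0 < ρ := by linarith
    have hTpos : 0 < T := by linarith
    set m : ℕ := ⌈T / ρ⌉₊ with hmdef
    have hm1 : (1 : ℝ) < T / ρ := by rw [lt_div_iff₀ hρpos, one_mul]; exact hTρ
    have hmge : T / ρ ≤ (m : ℝ) := Nat.le_ceil _
    have hmlt : (m : ℝ) < T / ρ + 1 := Nat.ceil_lt_add_one (by positivity)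
    have hmpos : (0 : ℝ) < m := by linarith
    have hm2 : 2 ≤ m := by
      have : (1 : ℝ) < m := by linarith
      have : 1 < m := by exact_mod_cast this
      omega
    set τ : ℝ := T / m with hτdef
    have hτρ : τ ≤ ρ := by
      rw [hτdef, div_le_iff₀ hmpos]
      have := (div_le_iff₀ hρpos).1 hmge
      linarith
    have hτ1 : 1 ≤ τ := by
      rw [hτdef, le_div_iff₀ hmpos, one_mul]
      -- `m < T/ρ + 1 ≤ T` needs `T/ρ + 1 ≤ T`, i.e. `T ≥ ρ/(ρ−1)`; use instead `m ρ < T + ρ ≤ 2T`... via `τ > ρ/2 ≥ 1`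
      have h1 : (m : ℝ) * ρ < T + ρ := by
        have := (lt_div_iff₀ hρpos).1 (by linarith [hmlt] : (m : ℝ) - 1 < T / ρ)
        linarith
      nlinarith
    have hmτ : (m : ℝ) * τ = T := by rw [hτdef]; field_simp
    -- `S j` = the part of `Bd` below height `a + j τ`
    have hstep : ∀ j : ℕ, 1 ≤ j → j ≤ m →
        contactDeficiency (Bd.filter fun z => ⟪z, ν⟫_ℝ ≤ a + j * τ) ≤ j * (K₀ * ρ ^ 2) := by
      intro j hj
      induction j, hj using Nat.le_induction with
      | base =>
        intro _
        simp only [Nat.cast_one, one_mul]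
        refine hpiece τ hτ1 hτρ a (a + τ) (by ring) _ fun z => ?_
        rw [Finset.mem_filter, hBd]
        constructor
        · rintro ⟨⟨hz, h1, -, h3⟩, h2⟩; exact ⟨hz, h1, by linarith, h3⟩
        · rintro ⟨hz, h1, h2, h3⟩
          refine ⟨⟨hz, h1, ?_, h3⟩, by linarith⟩
          have : a + τ ≤ b := by
            have : (1 : ℝ) * τ ≤ m * τ := mul_le_mul_of_nonneg_right (by exact_mod_cast (by omega : 1 ≤ m))
              (by linarith)
            linarith
          linarith
      | succ j hj ih =>
        intro hjm
        have ih' := ih (by omega)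
        have hjm' : (j : ℝ) + 1 ≤ m := by exact_mod_cast hjm
        set S := Bd.filter fun z => ⟪z, ν⟫_ℝ ≤ a + j * τ with hS
        set Pj := Bd.filter fun z => a + j * τ ≤ ⟪z, ν⟫_ℝ ∧ ⟪z, ν⟫_ℝ ≤ a + (j + 1) * τ with hPj
        have hτ0 : 0 ≤ τ := by linarith
        have hunion : (Bd.filter fun z => ⟪z, ν⟫_ℝ ≤ a + ((j + 1 : ℕ) : ℝ) * τ) = S ∪ Pj := by
          ext z
          simp only [hS, hPj, Finset.mem_union, Finset.mem_filter, Nat.cast_add, Nat.cast_one]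
          constructor
          · rintro ⟨hz, h⟩
            rcases le_total ⟪z, ν⟫_ℝ (a + j * τ) with h' | h'
            · exact Or.inl ⟨hz, h'⟩
            · exact Or.inr ⟨hz, h', h⟩
          · rintro (⟨hz, h⟩ | ⟨hz, -, h⟩)
            · exact ⟨hz, by nlinarith⟩
            · exact ⟨hz, h⟩
        rw [hunion]
        have hpack : ∀ p ∈ S ∩ Pj, ∀ q ∈ S ∩ Pj, p ≠ q → 1 ≤ dist p q := by
          intro p hp q hq hpq
          have hp' := ((hBd p).1 (Finset.mem_filter.1 (Finset.mem_inter.1 hp).1).1).1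
          have hq' := ((hBd q).1 (Finset.mem_filter.1 (Finset.mem_inter.1 hq).1).1).1
          exact movedFcc_one_le_dist L s hp' hq' hpq
        have hP : contactDeficiency Pj ≤ K₀ * ρ ^ 2 := by
          refine hpiece τ hτ1 hτρ (a + j * τ) (a + (j + 1) * τ) (by ring) Pj fun z => ?_
          rw [hPj, Finset.mem_filter, hBd]
          constructor
          · rintro ⟨⟨hz, -, -, h3⟩, h1, h2⟩; exact ⟨hz, h1, h2, h3⟩
          · rintro ⟨hz, h1, h2, h3⟩
            refine ⟨⟨hz, ?_, ?_, h3⟩, h1, h2⟩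
            · nlinarith
            · have : ((j : ℝ) + 1) * τ ≤ m * τ := mul_le_mul_of_nonneg_right hjm' hτ0
              linarith
        calc contactDeficiency (S ∪ Pj) ≤ contactDeficiency S + contactDeficiency Pj :=
              contactDeficiency_union_le_add S Pj hpack
          _ ≤ j * (K₀ * ρ ^ 2) + K₀ * ρ ^ 2 := add_le_add ih' hP
          _ = ((j + 1 : ℕ) : ℝ) * (K₀ * ρ ^ 2) := by push_cast; ring
    have hfull : (Bd.filter fun z => ⟪z, ν⟫_ℝ ≤ a + m * τ) = Bd := by
      ext z
      simp only [Finset.mem_filter, and_iff_left_iff_imp]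
      intro hz
      have := ((hBd z).1 hz).2.2.1
      rw [hmτ]; linarith
    have h : contactDeficiency Bd ≤ (m : ℝ) * (K₀ * ρ ^ 2) := by
      have := hstep m (by omega) le_rfl
      rwa [hfull] at this
    -- `m K₀ ρ² ≤ (T/ρ + 1) K₀ ρ² = K₀ T ρ + K₀ ρ² ≤ 2 K₀ T ρ`
    have h1 : (m : ℝ) * (K₀ * ρ ^ 2) ≤ 2 * K₀ * T * ρ := by
      have e1 : (m : ℝ) * (K₀ * ρ ^ 2) ≤ (T / ρ + 1) * (K₀ * ρ ^ 2) :=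
        mul_le_mul_of_nonneg_right hmlt.le (by positivity)
      have e2 : (T / ρ + 1) * (K₀ * ρ ^ 2) = K₀ * T * ρ + K₀ * ρ ^ 2 := by
        field_simp
      have e3 : K₀ * ρ ^ 2 ≤ K₀ * T * ρ := by
        have : ρ ^ 2 ≤ T * ρ := by nlinarith
        nlinarith
      linarith
    have h2 : 0 ≤ 2 * (Real.sqrt 2 / 4 * ∑ᶠ w ∈ {w ∈ fccStacking 1 (Real.sqrt (2 / 3)) | ‖w‖ = 1},
        |⟪w, L.symm ν⟫_ℝ|) * Real.pi * ρ ^ 2 :=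
      mul_nonneg (mul_nonneg (mul_nonneg (by norm_num) hφ0) hπ) (sq_nonneg ρ)
    linarith

/-! ## K1 ⟹ the capped T-form adhesion law for fcc hosts -/

open Summit.Ventures.Crystal3D.Cruxes.TextureLiminf.TexShadow (stacking)

/-- The fcc stacking of lane T's vocabulary is the rigidly moved lattice `L Λ₀ + s`. -/
theorem stacking_constHagg_eq (L : EuclideanSpace ℝ (Fin 3) ≃ₗᵢ[ℝ] EuclideanSpace ℝ (Fin 3))
    (s : EuclideanSpace ℝ (Fin 3)) :
    stacking L s constHagg = (fun r => L r + s) '' fccStacking 1 (Real.sqrt (2 / 3)) := rfl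

open scoped Classical in
/-- **K1 ⟹ the CAPPED T-FORM adhesion law for fcc hosts** (explicit statement; the `Prop`
`BarlowAdhesionTCapFcc` of `…NoReconstructionGainAdhesionTCapDefs` is literally this conclusion).  Assume the crux
`NoReconstructionGain`.  Then there are `R ≥ 1` and `C` such that for every frame `L`, origin `s`, unit normal
`ν`, cap `h ≥ 0`, radius `ρ ≥ R` and every finite packing `X` with `−2R ≤ ⟪p,ν⟫ ≤ h` and `‖p‖² − ⟪p,ν⟫² ≤ ρ²`
on `X`, in which the slab `{−2R ≤ ⟪p,ν⟫ ≤ −R}` of `stacking L s constHagg = L Λ₀ + s` is complete: with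
`P := X ∩ stacking`, `B := X ∖ stacking` there is a finite set `Q` of vacant stacking sites (the vacant sites of the
cell's lattice body up to height `h + 1`) with `#cross(P,B) ≤ D(B) + (#cross(P,Q) − D(Q)) + C·(1+h)·ρ`. -/
theorem barlowAdhesionTCapFcc_of_noReconstructionGain'
    (hNRG : Summit.Ventures.Crystal3D.Theses.StickyWulffConstant.NoReconstructionGain) :
    ∃ R C : ℝ, 1 ≤ R ∧ ∀ (L : EuclideanSpace ℝ (Fin 3) ≃ₗᵢ[ℝ] EuclideanSpace ℝ (Fin 3))
      (s ν : EuclideanSpace ℝ (Fin 3)), ‖ν‖ = 1 →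
      ∀ h : ℝ, 0 ≤ h → ∀ ρ : ℝ, R ≤ ρ → ∀ X : Finset (EuclideanSpace ℝ (Fin 3)),
      (∀ p ∈ X, ∀ q ∈ X, p ≠ q → 1 ≤ dist p q) →
      (∀ p ∈ X, -(2 * R) ≤ ⟪p, ν⟫_ℝ ∧ ‖p‖ ^ 2 - ⟪p, ν⟫_ℝ ^ 2 ≤ ρ ^ 2) →
      (∀ p ∈ X, ⟪p, ν⟫_ℝ ≤ h) →
      (∀ p ∈ stacking L s constHagg, -(2 * R) ≤ ⟪p, ν⟫_ℝ → ⟪p, ν⟫_ℝ ≤ -R →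
        ‖p‖ ^ 2 - ⟪p, ν⟫_ℝ ^ 2 ≤ ρ ^ 2 → p ∈ X) →
      ∃ Q : Finset (EuclideanSpace ℝ (Fin 3)), (↑Q : Set (EuclideanSpace ℝ (Fin 3))) ⊆ stacking L s constHagg ∧
        Disjoint Q X ∧
        ((((X.filter fun p => p ∈ stacking L s constHagg) ×ˢ
              (X.filter fun p => p ∉ stacking L s constHagg)).filter
            fun pq => dist pq.1 pq.2 = 1).card : ℝ) ≤
          contactDeficiency (X.filter fun p => p ∉ stacking L s constHagg) +
            ((((((X.filter fun p => p ∈ stacking L s constHagg) ×ˢ Q).filter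
                fun pq => dist pq.1 pq.2 = 1).card : ℕ) : ℝ) - contactDeficiency Q) +
            C * (1 + h) * ρ := by
  obtain ⟨R, C, hR, hA⟩ := noReconstructionGain_affine hNRG
  obtain ⟨CB, hCB0, hB⟩ := movedBody_deficit_le
  refine ⟨R, |C| + CB * (2 * R + 2), by linarith, ?_⟩
  intro L s ν hν hgt hhgt ρ hρ X hX hcyl hcap hslab
  have hρ0 : 0 ≤ ρ := by linarith
  -- the lattice part `P` and the off-lattice part `B`
  set P : Finset (EuclideanSpace ℝ (Fin 3)) := X.filter fun p => p ∈ stacking L s constHagg with hPdef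
  set B : Finset (EuclideanSpace ℝ (Fin 3)) := X.filter fun p => p ∉ stacking L s constHagg with hBdef
  have hPX : P ⊆ X := Finset.filter_subset _ _
  have hXP : X \ P = B := by
    ext z
    simp only [hPdef, hBdef, Finset.mem_sdiff, Finset.mem_filter]
    tauto
  -- (1) the crux, placement-free: `2φπρ² − Cρ ≤ D(X)`
  have h1 := hA L s ν hν ρ hρ X hX (fun p hp => hslab p hp)
  -- (2) split over `P ⊆ X`
  have h2 := contactDeficiency_sdiff_split hPX
  rw [hXP] at h2
  -- (3) the cell's lattice body up to height `h + 1`, and its vacant part `Q`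
  obtain ⟨Bd, hBd⟩ := exists_movedBody L s ν (-(2 * R)) (hgt + 1) ρ
  have hPBd : P ⊆ Bd := by
    intro z hz
    obtain ⟨hzX, hzS⟩ := Finset.mem_filter.1 hz
    obtain ⟨hz1, hz3⟩ := hcyl z hzX
    exact (hBd z).2 ⟨hzS, hz1, by linarith [hcap z hzX], hz3⟩
  set Q : Finset (EuclideanSpace ℝ (Fin 3)) := Bd \ P with hQdef
  have h3 := contactDeficiency_sdiff_split hPBd
  have h4 := hB L s ν hν (hgt + 1 + 2 * R) (by linarith) (-(2 * R)) (hgt + 1) (by ring) ρ (by linarith) Bd hBd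
  refine ⟨Q, ?_, ?_, ?_⟩
  · intro z hz
    have hz' := (Finset.mem_sdiff.1 (Finset.mem_coe.1 hz)).1
    exact ((hBd z).1 hz').1
  · rw [Finset.disjoint_left]
    intro z hzQ hzX
    obtain ⟨hzBd, hzP⟩ := Finset.mem_sdiff.1 hzQ
    exact hzP (Finset.mem_filter.2 ⟨hzX, ((hBd z).1 hzBd).1⟩)
  · -- (4) bookkeeping
    have h5 : CB * (hgt + 1 + 2 * R) * ρ + C * ρ ≤ (|C| + CB * (2 * R + 2)) * (1 + hgt) * ρ := by
      have e1 : C * ρ ≤ |C| * (1 + hgt) * ρ := by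
        have : C ≤ |C| * (1 + hgt) := by
          calc C ≤ |C| := le_abs_self C
            _ = |C| * 1 := (mul_one _).symm
            _ ≤ |C| * (1 + hgt) := mul_le_mul_of_nonneg_left (by linarith) (abs_nonneg _)
        exact mul_le_mul_of_nonneg_right this hρ0
      have e2 : CB * (hgt + 1 + 2 * R) ≤ CB * (2 * R + 2) * (1 + hgt) := by
        have : hgt + 1 + 2 * R ≤ (2 * R + 2) * (1 + hgt) := by nlinarith
        nlinarith
      have e3 := mul_le_mul_of_nonneg_right e2 hρ0
      nlinarith
    linarith

/-- **K1 ⟹ lane T's capped T-form for fcc hosts, by name:** `NoReconstructionGain → BarlowAdhesionTCapFcc`. -/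
theorem barlowAdhesionTCapFcc_of_noReconstructionGain
    (hNRG : Summit.Ventures.Crystal3D.Theses.StickyWulffConstant.NoReconstructionGain) :
    Summit.Ventures.Crystal3D.Cruxes.TextureLiminf.TexShadow.BarlowAdhesionTCapFcc :=
  barlowAdhesionTCapFcc_of_noReconstructionGain' hNRG

end Summit.Ventures.Crystal3D.Theorems

end
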